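import Summits.BirchSwinnertonDyer.Rank1Residual.Additive.O7RankOneStatements
import Summits.BirchSwinnertonDyer.Rank1Residual.Additive.X3CaseOneMember
import HarnessLib
import HarnessLib.Audit.Tags

/-!
# Rung K1 of the BirchSwinnertonDyer ladder as a CLOSED LEAF (D-0059 / D-0061): the LOWER half of `BSD(E,p)`
# on the additive potentially ORDINARY / MULTIPLICATIVE rows in analytic rank `≤ 1` (cell `bsd-addord`, rows B2 = N10 and B6 = O7-ord)

ROUTE VOCABULARY CONE (v2). Besides `O7RankOneStatements` (the cells `N10.CellM` / `N10.CellGordTwo` /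
`N10.CellGordHigher`, `N10.Locus`, `O7.LowerHalf`) this file imports `Additive/X3CaseOneMember.lean`
(the predicates `CaseOneDatum`, `HasCaseOneMember`; definitions only) so that the import cone of this
alternative-closer module contains every tree declaration the K1 ledger route's items quantify over
(route files may import only Mathlib / Literature / HarnessLib / the Statement and the closer module).

HONEST FRAMING. Nothing is asserted. This file only NAMES, as one closed `Prop` (no section
variables; `#check @AdditiveOrdinaryLowerHalf : Prop`), the target that the cell `bsd-addord`
attacks, so that a ledger route can close it (`ledger route open … --closes-target
Summit.BirchSwinnertonDyer.Rank1Residual.Additive.AdditiveOrdinaryLowerHalf`, ruling D-0061): for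
every elliptic curve `E/ℚ` (globally minimal model `W`) of analytic rank `≤ 1` and every ODD prime `p`
of ADDITIVE reduction at which `E` is potentially multiplicative or potentially good ordinary of
Delbourgo's type (G) (`N10.Locus W p := p ≠ 2 ∧ Addv W p ∧ (PotMult W p ∨ TypeGOrd W p)`,
`Additive/N10LowerHalfStatements.lean`), the "main-conjecture / Eisenstein" half of the missing
`p`-part output holds: `#Ш(E)_an` is a rational `q` with `ord_p q ≤ ord_p #Ш(E)`
(`Typed.MissingLowerBoundAt W p`, `Literature/…/Rank1Residual/Typed/Basic.lean:60`, Miller's currency).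
It is EXACTLY the conjunction of the two statements of record already in the tree, `N10.LowerHalf`
(analytic rank `0`, l.250 of `N10LowerHalfStatements.lean`) and `O7.LowerHalf` (analytic rank `1`,
`O7RankOneStatements.lean:132`) — `additiveOrdinaryLowerHalf_iff` below, pure bookkeeping — i.e. the
programme's rung «K1 additive-branch IMC lower bound ⇒ B2 (N10, r = 0, loci (M) ∪ (G-ord)) · with K1′
(p-adic Gross–Zagier on the branch) ⇒ B6 (O7-ord, r = 1)» (FULL-BSD-RANK1-PROGRAMME §2 K1/K1′).
The statement is image-free, as the statements of record are: it contains the reducible (X3) and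
irreducible (X4) rows alike, hence also the ordinary rows of O8 (X4 ∧ ¬surj, routed to `bsd-smallim`);
it is NOT weakened to the sub-rows the cell has reached (those become `_holds` links on route items).
Why only the LOWER half: on these rows the UPPER half (`ord_p #Ш ≤ ord_p #Ш_an`) is a kernel theorem
from published facts in analytic rank `0` (Kato 2004 Thm. 17.4(3) / Wuthrich 2014 Thm. 16 on the
`ω^{(p−1)/2}`-component: `ClassX4M.missingUpperBoundAt_rankZero_of_surj`,
`ClassX3M.missingUpperBoundAt_rankZero`, `ClassX4Gord.missingUpperBoundAt_rankZero_of_katoComponent_of_surj`),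
and in analytic rank `1` it is reduced to lower halves on X4(M) ∧ surj (`O7RankOneStatements` §3);
the LOWER half is in print at NO additive pair (Skinner–Urban 2014 Thm. 3.6.4 needs tame
level/character hypotheses failing on the twisted branch; Delbourgo 1998 states the Main Conjecture,
p. 151, and proves the algebraic side only). OPEN PROBLEM stated as a `Prop`.

References: Delbourgo, Compositio Math. 113 (1998) 123–154, Main Conjecture p. 151 [Delbourgo1998];
Delbourgo, J. Number Theory 95 (2002) 38–71, Main Theorem p. 40 [Delbourgo2002]; Miller, LMS J.
Comput. Math. 14 (2011) Def. 1.1 [Miller2011LMS]; Skinner–Urban, Invent. Math. 195 (2014) Thm. 3.6.4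
[SkinnerUrban2014].
-/

noncomputable section

open scoped Classical

open WeierstrassCurve Literature.NumberTheory.EllipticCurves
  Literature.NumberTheory.EllipticCurves.Rank1Residual
  Literature.NumberTheory.EllipticCurves.Rank1Residual.Typed

namespace Summit.BirchSwinnertonDyer.Rank1Residual.Additive

/-- **Rung K1 (closed leaf): the lower half of `BSD(E,p)` on the additive potentially ordinary /
multiplicative rows in analytic rank `≤ 1`.** For every `E/ℚ` (globally minimal `W`) with
`ord_{s=1} L(E,s) ≤ 1` and every odd additive prime `p` with `E` potentially multiplicative or
potentially good ordinary of type (G) at `p`: `#Ш(E)_an = q ∈ ℚ` with `ord_p q ≤ ord_p #Ш(E)`.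
`= N10.LowerHalf ∧ O7.LowerHalf` (`additiveOrdinaryLowerHalf_iff`). OPEN; nothing asserted.
[cite: Delbourgo1998, Main Conjecture (p. 151) (shape only; nothing asserted)]
[cite: Delbourgo2002, Main Theorem (A)–(D) (p. 40) (shape only; nothing asserted)] [cite: Miller2011LMS, Def. 1.1] -/
@[conjecture] def AdditiveOrdinaryLowerHalf : Prop :=
  ∀ (W : WeierstrassCurve ℚ) [W.IsElliptic] [W.IsGloballyMinimal] (p : ℕ) [Fact p.Prime],
    W.analyticRank ≤ 1 → N10.Locus W p → MissingLowerBoundAt W p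

/-- The leaf is exactly the conjunction of the two statements of record (analytic rank `0`: `N10.LowerHalf`;
analytic rank `1`: `O7.LowerHalf`). Bookkeeping (`r ≤ 1 ↔ r = 0 ∨ r = 1`). [folklore] -/
theorem additiveOrdinaryLowerHalf_iff :
    AdditiveOrdinaryLowerHalf ↔ N10.LowerHalf ∧ O7.LowerHalf := by
  constructor
  · intro h
    exact ⟨fun W _ _ p _ hr hL ↦ h W p (by omega) hL, fun W _ _ p _ hr hL ↦ h W p (by omega) hL⟩
  · rintro ⟨h0, h1⟩ W _ _ p _ hr hL
    rcases Nat.le_one_iff_eq_zero_or_eq_one.mp hr with h | h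
    · exact h0 W p h hL
    · exact h1 W p h hL

/-- By cells: the leaf is the conjunction of the six cell statements ((M) / (G-ord, `e = 2`) /
(G-ord, `e ∈ {3,4,6}`) × analytic rank `0` / `1`) through `N10.lowerHalf_iff` and `N10.locus_iff_cells`;
recorded here only for the rank-`0` side, whose three cells are already named in the tree. [folklore] -/
theorem additiveOrdinaryLowerHalf_iff_cells_rankZero_and_rankOne :
    AdditiveOrdinaryLowerHalf ↔
      (N10.LowerHalfM ∧ N10.LowerHalfGordTwo ∧ N10.LowerHalfGordHigher) ∧ O7.LowerHalf := by
  rw [additiveOrdinaryLowerHalf_iff, N10.lowerHalf_iff]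

end Summit.BirchSwinnertonDyer.Rank1Residual.Additive

end
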